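import Mathlib.Data.Real.Basic
import Mathlib.Tactic.Linarith
import Mathlib.Tactic.Ring
import Mathlib.Tactic.Positivity
import HarnessLib

/-!
# The chord and concavity calculus of the increasing-star pencil along an arbitrary pair (algebraic core)

Support file for the Sahi programme (`--supports stmt-CriticalPhenomena-4575`, prover prim-nh-lead-4575 lead gen 121).  No definitions,
no named facts, no sorries; standard axioms; pure real arithmetic.  Memo
`run/shared/lean/prim/prim-sahi/FROM-prim-nh-lead-4575-g121-CHORDS.md` §0, §2.

SETTING (paper level).  Rooted weighted graph, targets `a, b, c`, events `A = {s↔a}` etc., and the pencil member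
`f_α = α·P(ABC) − Σ_cyc P(A)P(BC) + (3−α)·P(A)P(B)P(C)` (`α = 2`: the increasing star `E₃`; `α = 3/2`: `2F`, `F = E₃ − ½X`,
STAR½; the pencil is admissible iff `α ≥ 3/2`).  Along ANY pair `e` of weight `t` every moment is affine,
`m_T(t) = m_T(0) + t·δ_T` with `δ_T ≥ 0` the pivotality probability of `e` for `∩_{x∈T}{s↔x}`, so `f_α(t)` is a cubic.  This file
kernel-checks the algebra that the memo's censuses, annealers and LP rows all rest on:

* `pencilChord_identity` — `f_α(t) − [(1−t)f_α(0) + t·f_α(1)] = t(1−t)·BR_α(t)`,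
  `BR_α(t) = Σ_cyc δ_aδ_bc − (3−α)[Σ_cyc m_a(0)δ_bδ_c + (1+t)δ_aδ_bδ_c]` (for `α = 2` this is the PIVOTAL FORM of a chord, lead gen 119);
* `pencilBracket_at_one_le` — for `α ≤ 3` and nonnegative slopes, `BR_α(1) ≤ BR_α(t)` on `t ≤ 1`: chord-positivity at every weight follows from
  `CH_α := BR_α(1) ≥ 0`, and `pencilChord_nonneg_of_CH` records the consequence `(1−t)f(0) + t f(1) ≤ f(t)`;
* `pencilBracket_alpha_shift` — `BR_α(t) = BR_{3/2}(t) + (α − 3/2)·[Σ m_a(0)δ_bδ_c + (1+t)δ_aδ_bδ_c]`: since the bracket of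
  `X = P(ABC) − PPP` is nonnegative (`X` is concave along every pair), chord/concavity statements are MONOTONE in `α` and the `α = 3/2` ones are
  the strongest (`pencilBracket_mono_alpha`);
* `pencilSecondDeriv_coeffs` — the cubic's power-basis coefficients: `f_α(t) = f_α(0) + c₁t + c₂t² + c₃t³` with
  `c₂ = −[Σ_cyc δ_aδ_bc − (3−α)Σ_cyc m_a(0)δ_bδ_c]` and `c₃ = (3−α)δ_aδ_bδ_c`, i.e. `f″(t) = −2V_α(t)`,
  `V_α(t) = Σδ_aδ_bc − (3−α)Σ m_a(t)δ_bδ_c` (non-increasing), so concavity on `[0,1]` ⟺ `V_α(1) ≥ 0`;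
* `ttConcavity_form` — along a pair `e = {a,b}` joining two TARGETS one has `δ_ab = δ_a + δ_b`, `m_a(1) = m_b(1) = M := P(A∪B)`,
  `δ_ac = δ_c + y₂`, `δ_bc = δ_c + x₂`, `m_c(1) = p_c + δ_c`; then
  `V_α(1) = δ_c(δ_a+δ_b)(2 − (3−α)M) + δ_a x₂ + δ_b y₂ − (3−α)(p_c + δ_c)δ_aδ_b` — the law-level form of the memo's CONJECTURE
  (TT-CONCAVITY½) `V_{3/2}(1) ≥ 0` (sharp; census/annealer-clean; not proved here).

The probabilistic identifications of the slopes are NOT formalised here (exact-arithmetic checks: `lab-gen121/chord/engine.py`).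
-/

namespace Summit.CriticalPhenomena.PercolationContinuityZ3.Theorems

namespace IncStar

/-- **Chord identity of the pencil along an arbitrary pair.**  With affine moments `m_T(t) = m_T(0) + t·δ_T` the pencil member
`f_α(t) = α·m_abc(t) − Σ_cyc m_a(t)m_bc(t) + (3−α)m_a(t)m_b(t)m_c(t)` satisfies
`f_α(t) − [(1−t)f_α(0) + t f_α(1)] = t(1−t)·(Σ_cyc δ_aδ_bc − (3−α)(Σ_cyc m_a(0)δ_bδ_c + (1+t)δ_aδ_bδ_c))`. [this work] -/
theorem pencilChord_identity (α t ma mb mc mab mac mbc mabc da db dc dab dac dbc dabc : ℝ) :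
    let f : ℝ → ℝ := fun x =>
      α * (mabc + x * dabc) - ((ma + x * da) * (mbc + x * dbc) + (mb + x * db) * (mac + x * dac) + (mc + x * dc) * (mab + x * dab))
        + (3 - α) * ((ma + x * da) * (mb + x * db) * (mc + x * dc))
    f t - ((1 - t) * f 0 + t * f 1)
      = t * (1 - t) * ((da * dbc + db * dac + dc * dab)
          - (3 - α) * ((ma * db * dc + mb * da * dc + mc * da * db) + (1 + t) * (da * db * dc))) := by
  intro f
  simp only [f]
  ring

/-- **The chord bracket is smallest at `t = 1`.**  For `α ≤ 3` and nonnegative slopes the bracket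
`BR_α(t) = S₁ − (3−α)(S₂ + (1+t)δ_aδ_bδ_c)` is non-increasing in `t`, so `BR_α(1) ≤ BR_α(t)` for `t ≤ 1`:
chord-positivity at EVERY weight follows from `CH_α := BR_α(1) ≥ 0`. [this work] -/
theorem pencilBracket_at_one_le (α t S1 S2 da db dc : ℝ) (hα : α ≤ 3) (ht : t ≤ 1)
    (hda : 0 ≤ da) (hdb : 0 ≤ db) (hdc : 0 ≤ dc) :
    S1 - (3 - α) * (S2 + (1 + 1) * (da * db * dc)) ≤ S1 - (3 - α) * (S2 + (1 + t) * (da * db * dc)) := by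
  have hddd : 0 ≤ da * db * dc := mul_nonneg (mul_nonneg hda hdb) hdc
  have h3 : 0 ≤ 3 - α := by linarith
  nlinarith [mul_nonneg h3 hddd]

/-- **Chords from the bracket.**  If `0 ≤ t ≤ 1` and the worst bracket `CH_α = S₁ − (3−α)(S₂ + 2δ_aδ_bδ_c)` is nonnegative
(`α ≤ 3`, nonnegative slopes), then `f_α` lies above its chord at `t`:
`(1−t)f_α(0) + t f_α(1) ≤ f_α(t)`.  (Deletion–contraction induction step: `f_α(G) ≥ (1−w_e)f_α(G∖e) + w_e f_α(G/e)`.) [this work] -/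
theorem pencilChord_nonneg_of_CH (α t ma mb mc mab mac mbc mabc da db dc dab dac dbc dabc : ℝ)
    (hα : α ≤ 3) (ht0 : 0 ≤ t) (ht1 : t ≤ 1) (hda : 0 ≤ da) (hdb : 0 ≤ db) (hdc : 0 ≤ dc)
    (hCH : 0 ≤ (da * dbc + db * dac + dc * dab)
        - (3 - α) * ((ma * db * dc + mb * da * dc + mc * da * db) + 2 * (da * db * dc))) :
    let f : ℝ → ℝ := fun x =>
      α * (mabc + x * dabc) - ((ma + x * da) * (mbc + x * dbc) + (mb + x * db) * (mac + x * dac) + (mc + x * dc) * (mab + x * dab))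
        + (3 - α) * ((ma + x * da) * (mb + x * db) * (mc + x * dc))
    (1 - t) * f 0 + t * f 1 ≤ f t := by
  intro f
  have key := pencilChord_identity α t ma mb mc mab mac mbc mabc da db dc dab dac dbc dabc
  simp only at key
  have hmono := pencilBracket_at_one_le α t (da * dbc + db * dac + dc * dab) (ma * db * dc + mb * da * dc + mc * da * db)
    da db dc hα ht1 hda hdb hdc
  have hBR : 0 ≤ (da * dbc + db * dac + dc * dab)
      - (3 - α) * ((ma * db * dc + mb * da * dc + mc * da * db) + (1 + t) * (da * db * dc)) := by
    have h2 : (1 : ℝ) + 1 = 2 := by norm_num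
    rw [h2] at hmono
    linarith
  have ht : 0 ≤ t * (1 - t) := mul_nonneg ht0 (by linarith)
  have hdiff : 0 ≤ f t - ((1 - t) * f 0 + t * f 1) := by
    have : f t - ((1 - t) * f 0 + t * f 1)
        = t * (1 - t) * ((da * dbc + db * dac + dc * dab)
          - (3 - α) * ((ma * db * dc + mb * da * dc + mc * da * db) + (1 + t) * (da * db * dc))) := key
    rw [this]
    exact mul_nonneg ht hBR
  linarith

/-- **α-shift of the bracket.**  `BR_α(t) = BR_{3/2}(t) + (α − 3/2)·[Σ_cyc m_a(0)δ_bδ_c + (1+t)δ_aδ_bδ_c]`: the pencil member is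
`f_α = f_{3/2} + (α − 3/2)·X` with `X = P(ABC) − P(A)P(B)P(C)`, whose own chord bracket is the nonnegative square bracket
(`X` is concave along every pair). [this work] -/
theorem pencilBracket_alpha_shift (α t S1 S2 ddd : ℝ) :
    S1 - (3 - α) * (S2 + (1 + t) * ddd) = (S1 - (3 - 3 / 2) * (S2 + (1 + t) * ddd)) + (α - 3 / 2) * (S2 + (1 + t) * ddd) := by
  ring

/-- **Monotonicity in α.**  If the `α = 3/2` bracket is nonnegative, so is every bracket with `α ≥ 3/2` (given `S₂ ≥ 0`, `δ_aδ_bδ_c ≥ 0`,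
`t ≥ −1`): the STAR½ chord/concavity statements are the strongest in the admissible pencil and imply those for `E₃` (`α = 2`).
[this work] -/
theorem pencilBracket_mono_alpha (α t S1 S2 ddd : ℝ) (hα : 3 / 2 ≤ α) (hS2 : 0 ≤ S2) (hddd : 0 ≤ ddd) (ht : -1 ≤ t)
    (h : 0 ≤ S1 - (3 - 3 / 2) * (S2 + (1 + t) * ddd)) :
    0 ≤ S1 - (3 - α) * (S2 + (1 + t) * ddd) := by
  rw [pencilBracket_alpha_shift α t S1 S2 ddd]
  have hb : 0 ≤ S2 + (1 + t) * ddd := by nlinarith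
  have hα' : 0 ≤ α - 3 / 2 := by linarith
  exact add_nonneg h (mul_nonneg hα' hb)

/-- **Power-basis coefficients of the cubic (second-derivative form).**
`f_α(t) = f_α(0) + c₁t + c₂t² + c₃t³` with `c₂ = −[Σ_cyc δ_aδ_bc − (3−α)Σ_cyc m_a(0)δ_bδ_c]`, `c₃ = (3−α)δ_aδ_bδ_c`
(and `c₁` the first-order term); hence `f″(t) = 2c₂ + 6c₃t = −2V_α(t)` with `V_α(t) = Σδ_aδ_bc − (3−α)Σ m_a(t)δ_bδ_c`
non-increasing, and `f_α` is concave on `[0,1]` iff `V_α(1) = −(c₂ + 3c₃) ≥ 0`. [this work] -/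
theorem pencilSecondDeriv_coeffs (α t ma mb mc mab mac mbc mabc da db dc dab dac dbc dabc : ℝ) :
    let f : ℝ → ℝ := fun x =>
      α * (mabc + x * dabc) - ((ma + x * da) * (mbc + x * dbc) + (mb + x * db) * (mac + x * dac) + (mc + x * dc) * (mab + x * dab))
        + (3 - α) * ((ma + x * da) * (mb + x * db) * (mc + x * dc))
    let c1 := α * dabc - (ma * dbc + da * mbc + mb * dac + db * mac + mc * dab + dc * mab)
        + (3 - α) * (da * mb * mc + ma * db * mc + ma * mb * dc)
    let c2 := -((da * dbc + db * dac + dc * dab) - (3 - α) * (ma * db * dc + mb * da * dc + mc * da * db))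
    let c3 := (3 - α) * (da * db * dc)
    f t = f 0 + c1 * t + c2 * t ^ 2 + c3 * t ^ 3 := by
  intro f c1 c2 c3
  simp only [f, c1, c2, c3]
  ring

/-- **Concavity criterion.**  With the coefficients of `pencilSecondDeriv_coeffs`, `−(c₂ + 3c₃t) = V_α(t)` equals
`Σ_cyc δ_aδ_bc − (3−α)Σ_cyc m_a(t)δ_bδ_c` where `m_a(t) = m_a(0) + tδ_a` (ring identity); in particular at `t = 1` the
criterion `V_α(1) ≥ 0` reads `Σ_cyc δ_aδ_bc ≥ (3−α)Σ_cyc m_a(1)δ_bδ_c`. [this work] -/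
theorem pencilV_eq (α t ma mb mc da db dc dab dac dbc : ℝ) :
    -( -((da * dbc + db * dac + dc * dab) - (3 - α) * (ma * db * dc + mb * da * dc + mc * da * db))
        + 3 * ((3 - α) * (da * db * dc)) * t)
      = (da * dbc + db * dac + dc * dab)
        - (3 - α) * ((ma + t * da) * db * dc + (mb + t * db) * da * dc + (mc + t * dc) * da * db) := by
  ring

/-- **Target–target form (law level).**  Along a pair `e = {a,b}` joining two TARGETS: opening `e` merges the clusters of `a` and
`b`, so `δ_ab = δ_a + δ_b`, `m_a(1) = m_b(1) = M` (`= P(A∪B)`), `δ_bc = δ_c + x₂`, `δ_ac = δ_c + y₂` (`x₂ = P(A∩C∖B)`,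
`y₂ = P(B∩C∖A)`), `m_c(1) = p_c + δ_c`; writing `u = δ_a = P(B∖A)`, `v = δ_b = P(A∖B)`, `g = δ_c`:
`V_α(1) = g(u+v)(2 − (3−α)M) + u·x₂ + v·y₂ − (3−α)(p_c + g)·u·v`.  For `α = 3/2` the memo's CONJECTURE (TT-CONCAVITY½) is
`0 ≤ V_{3/2}(1)`, i.e. `2g(u+v) + u x₂ + v y₂ ≥ (3/2)[M g (u+v) + (p_c+g) u v]` on every finite weighted graph (sharp; open). [this work] -/
theorem ttConcavity_form (α M pc u v g x2 y2 : ℝ) :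
    (u * (g + x2) + v * (g + y2) + g * (u + v)) - (3 - α) * (M * v * g + M * u * g + (pc + g) * u * v)
      = g * (u + v) * (2 - (3 - α) * M) + u * x2 + v * y2 - (3 - α) * (pc + g) * u * v := by
  ring

/-- **TT-concavity at a surely rooted endpoint.**  In the target–target form, if `b` is surely rooted (`M = 1`, `v = 0`, `x₂ = 0`)
then `V_{3/2}(1) = ½·g·u ≥ 0` — the equality face of the conjecture (the memo's sharpness family lives next to it). [this work] -/
theorem ttConcavity_sureEndpoint (pc u g y2 : ℝ) (hu : 0 ≤ u) (hg : 0 ≤ g) :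
    0 ≤ g * (u + 0) * (2 - (3 - 3 / 2) * 1) + u * 0 + 0 * y2 - (3 - 3 / 2) * (pc + g) * u * 0 := by
  nlinarith [mul_nonneg hg hu]

end IncStar

end Summit.CriticalPhenomena.PercolationContinuityZ3.Theorems
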